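import Mathlib
import Summits.RiemannHypothesis.RiemannHypothesis.Theorems.HandoffRealZeroCount
import Summits.RiemannHypothesis.RiemannHypothesis.Theorems.HandoffXiZeroCount
import Literature.NumberTheory.LFunctions.RiemannXiProofs
import Literature.NumberTheory.LFunctions.ZetaZerosProofs
import Literature.NumberTheory.LFunctions.ZetaRealAxis
import Literature.Analysis.Complex.FourierPolyaKiKimEngine
import HarnessLib

/-!
# ROUTE R-K «COUNT-AND-THIN», per window: the RH-free half — near-axis convergence bounds the count by `N₀(T)`

Handoff track (ROUTE 1′), prove-1 gen13; companion of `HandoffCountThin.lean` (idea-3 gen22 ROUTE R-K,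
TASK H-K1; HOME/handoff/IDEAS-finite-rank.md v3.3.1 §G22-3/§G22-4).

The proof of G22-T splits, window by window, into an RH-FREE half and a counting half; this file
records the RH-free half (built imports only; the counting half per window is
`HandoffCountThinNhds.riemannHypothesisInStripUpTo_of_count_of_nhds`):
* `sum_real_analyticOrderNatAt_eq_criticalZeroCount` — bridge: the REAL zeros of `Ξ` in `(0, T]`
  counted with analytic multiplicity are the tree's `criticalZeroCount T` (`N₀(T)`, zeros of `ζ` ON
  the critical line with `0 < Im ρ ≤ T`, with multiplicity).
* ★ `encard_realZeros_le_criticalZeroCount_of_nhds` — RH-FREE: for any family of entire functions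
  `û_t` and real normalisers `c_t` with `c_t û_t → Ξ` locally uniformly on an open neighbourhood of
  `[0, T]`, eventually `#{x ∈ (0, T] : û_t(x) = 0} ≤ N₀(T)`. Convergence near the axis ALONE bounds
  the approximants' real-zero count by the number of critical zeros of `ζ` (no reality, evenness,
  count hypothesis or property of `ζ` is used). With SC-2 at `T` this forces `N(T) ≤ N₀(T)`, i.e. RH up
  to height `T` — the counting half.
Nothing here is, or suggests, a proof of RH.
-/

set_option linter.dupNamespace false  -- the mandated namespace repeats `RiemannHypothesis`

noncomputable section

open Filter Set Topology Metric Complex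
open scoped BigOperators
open Literature.NumberTheory.LFunctions Literature.Analysis.Complex.KiKim

namespace Summit.RiemannHypothesis.RiemannHypothesis.Theorems

namespace CountThin

open RealZeroCount

/-! ## The real zeros of `Ξ` and `N₀(T)` -/

/-- **Bridge, real part.** `N₀(T) = criticalZeroCount T` equals the number of REAL zeros of `Ξ` in
`(0, T]`, counted with analytic multiplicity. -/
theorem sum_real_analyticOrderNatAt_eq_criticalZeroCount (T : ℝ) :
    ∑ z ∈ (xiZeros_finite T).toFinset.filter (fun z => z.im = 0),
      analyticOrderNatAt riemannXiUpper z = criticalZeroCount T := by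
  classical
  -- (the index set is finite; cf. `Literature.NumberTheory.LFunctions.criticalZeroSet_finite`)
  have hfin : {ρ ∈ zetaZeroBox (1 / 2) T | ρ.re = 1 / 2}.Finite :=
    (zetaZeroBox_finite (1 / 2) T).subset (sep_subset _ _)
  have hN : (criticalZeroCount T : ℤ) = ∑ ρ ∈ hfin.toFinset, riemannZetaZeroOrder ρ := by
    rw [criticalZeroCount, finsum_mem_eq_finite_toFinset_sum _ hfin]
    refine Int.toNat_of_nonneg (Finset.sum_nonneg fun ρ hρ => ?_)
    have hρ' := ((Set.Finite.mem_toFinset _).mp hρ).1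
    exact riemannZetaZeroOrder_nonneg_of_mem_zetaZeroBox hρ'
  have hX : ((∑ z ∈ (xiZeros_finite T).toFinset.filter (fun z => z.im = 0),
      analyticOrderNatAt riemannXiUpper z : ℕ) : ℤ) = ∑ ρ ∈ hfin.toFinset, riemannZetaZeroOrder ρ := by
    rw [Nat.cast_sum]
    refine Finset.sum_nbij' (fun z => 1 / 2 + I * z) (fun ρ => -I * (ρ - 1 / 2)) ?_ ?_ ?_ ?_ ?_
    · intro z hz
      obtain ⟨hz, hz0⟩ := Finset.mem_filter.mp hz
      obtain ⟨hΞ, h0, hT⟩ := (Set.Finite.mem_toFinset _).mp hz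
      obtain ⟨hζ, -, -⟩ := zeta_zero_of_riemannXiUpper_eq_zero hΞ
      have hre : (1 / 2 + I * z).re = 1 / 2 := by rw [re_half_add_I_mul, hz0, sub_zero]
      refine (Set.Finite.mem_toFinset _).mpr ⟨⟨hζ, hre.symm.le, by rw [hre]; norm_num, ?_, ?_⟩, hre⟩
      · rw [im_half_add_I_mul]; exact h0
      · rw [im_half_add_I_mul]; exact hT
    · intro ρ hρ
      obtain ⟨⟨hζ, -, -, him0, himT⟩, hre⟩ := (Set.Finite.mem_toFinset _).mp hρ
      obtain ⟨h0, h1⟩ := re_mem_Ioo_of_riemannZeta_eq_zero_of_im_ne_zero hζ him0.ne'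
      refine Finset.mem_filter.mpr ⟨(Set.Finite.mem_toFinset _).mpr ⟨?_, ?_, ?_⟩, ?_⟩
      · have hρ' : (1 / 2 : ℂ) + I * (-I * (ρ - 1 / 2)) = ρ := by
          have : I * I = -1 := Complex.I_mul_I
          linear_combination (-(ρ - 1 / 2)) * this
        rw [riemannXiUpper, hρ']
        exact (riemannXi_eq_zero_iff_holds ρ).mpr ⟨hζ, h0, h1⟩
      · simpa using him0
      · simpa using himT
      · simp [hre]
    · intro z _
      have : I * I = -1 := Complex.I_mul_I
      linear_combination -z * this
    · intro ρ _
      have : I * I = -1 := Complex.I_mul_I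
      linear_combination (-(ρ - 1 / 2)) * this
    · intro z hz
      obtain ⟨hz, -⟩ := Finset.mem_filter.mp hz
      obtain ⟨hz0, -, -⟩ := (Set.Finite.mem_toFinset _).mp hz
      obtain ⟨-, h0, h1⟩ := zeta_zero_of_riemannXiUpper_eq_zero hz0
      exact analyticOrderNatAt_riemannXiUpper_eq h0 h1
  exact_mod_cast hX.trans hN.symm

/-! ## The RH-free half: thin convergence bounds the real-zero count by `N₀(T)` -/

/-- ★ **RH-FREE.** Let `û_t = F t` be entire and `c_t` real, with `c_t û_t → Ξ` locally uniformly
on an open set `U ⊇ [0, T]`. Then eventually the number of real zeros of `û_t` in `(0, T]` is at most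
`N₀(T) = criticalZeroCount T`, the number of zeros of `ζ` ON the critical line up to height `T` (with
multiplicity). No hypothesis on `ζ`, none on the reality or parity of `û_t`. -/
theorem encard_realZeros_le_criticalZeroCount_of_nhds {F : ℝ → ℂ → ℂ}
    (hdiff : ∀ t, Differentiable ℂ (F t)) {c : ℝ → ℝ} {T : ℝ} {U : Set ℂ} (hUo : IsOpen U)
    (hseg : ∀ x ∈ Icc (0 : ℝ) T, (x : ℂ) ∈ U)
    (hloc : TendstoLocallyUniformlyOn (fun t z => ((c t : ℝ) : ℂ) * F t z) riemannXiUpper atTop U) :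
    ∀ᶠ t : ℝ in atTop,
      {x : ℝ | 0 < x ∧ x ≤ T ∧ F t x = 0}.encard ≤ (criticalZeroCount T : ℕ∞) := by
  classical
  set Φ : ℝ → ℂ → ℂ := fun t z => ((c t : ℝ) : ℂ) * F t z with hΦ
  have hΦd : ∀ t, Differentiable ℂ (Φ t) := fun t => (differentiable_const _).mul (hdiff t)
  set g : ℝ → ℝ := fun x => (riemannXiUpper x).re with hg
  set G : ℝ → ℝ → ℝ := fun t x => (Φ t x).re with hG
  set B := (xiZeros_finite T).toFinset with hB
  set Z : Finset ℝ := (B.filter fun z => z.im = 0).image Complex.re with hZ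
  set k : ℝ → ℕ := fun c => analyticOrderNatAt riemannXiUpper (c : ℂ) with hk
  have hΞreal := im_riemannXiUpper_ofReal_holds
  have hΞd := differentiable_riemannXiUpper'
  have hgzero : ∀ x ∈ Icc (0 : ℝ) T, g x = 0 → x ∈ Z := by
    intro x hx hgx
    have hΞx : riemannXiUpper x = 0 := Complex.ext (by simpa [g] using hgx) (by simpa using hΞreal x)
    have hx0 : 0 < x := by
      rcases hx.1.eq_or_lt with h | h
      · exact absurd (show (x : ℂ).re = 0 by simp [← h]) (re_ne_zero_of_riemannXiUpper_eq_zero hΞx)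
      · exact h
    refine Finset.mem_image.mpr ⟨(x : ℂ), Finset.mem_filter.mpr ⟨?_, by simp⟩, by simp⟩
    exact (Set.Finite.mem_toFinset _).mpr ⟨hΞx, by simpa using hx0, by simpa using hx.2⟩
  have hev : ∀ᶠ t : ℝ in atTop, {x | x ∈ Icc (0 : ℝ) T ∧ G t x = 0}.Finite ∧
      {x | x ∈ Icc (0 : ℝ) T ∧ G t x = 0}.ncard ≤ ∑ c ∈ Z, k c := by
    refine eventually_ncard_zeros_le (N := Z.sup k)
      (contDiff_re_ofReal (n := 0) hΞd).continuous
      hgzero ?_ ?_ (fun c hc => Finset.le_sup hc) (Eventually.of_forall fun t => contDiff_re_ofReal (hΦd t))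
      ?_ ?_
    · intro c _
      exact ((contDiff_re_ofReal (n := ⊤) hΞd).continuous_iteratedDeriv
        (k c) (by exact_mod_cast le_top)).continuousAt
    · intro c _
      rw [iteratedDeriv_re_ofReal hΞd]
      have him := im_iteratedDeriv_ofReal_eq_zero hΞd hΞreal (k c) c
      exact fun h => iteratedDeriv_analyticOrderNatAt_ne_zero (c : ℂ)
        (Complex.ext (by simpa using h) (by simpa using him))
    · have := tendstoUniformlyOn_re_iteratedDeriv hUo hΦd hloc hseg 0
      simp only [iteratedDeriv_zero] at this
      exact this
    · intro c _
      have := tendstoUniformlyOn_re_iteratedDeriv hUo hΦd hloc hseg (k c)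
      rw [iteratedDeriv_re_ofReal hΞd]
      refine this.congr (Eventually.of_forall fun t => ?_)
      intro x _
      change (iteratedDeriv (k c) (Φ t) x).re = iteratedDeriv (k c) (fun y : ℝ => (Φ t y).re) x
      rw [iteratedDeriv_re_ofReal (hΦd t)]
  have hreal_sum : ∑ c ∈ Z, k c = criticalZeroCount T := by
    rw [← sum_real_analyticOrderNatAt_eq_criticalZeroCount T, ← hB, hZ, Finset.sum_image]
    · refine Finset.sum_congr rfl fun z hz => ?_
      have hz0 : z.im = 0 := (Finset.mem_filter.mp hz).2
      simp only [k]
      congr 1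
      exact Complex.ext (by simp) (by simp [hz0])
    · intro z hz w hw h
      have hz0 : z.im = 0 := (Finset.mem_filter.mp hz).2
      have hw0 : w.im = 0 := (Finset.mem_filter.mp hw).2
      exact Complex.ext h (by rw [hz0, hw0])
  filter_upwards [hev] with t ⟨hfin, hle⟩
  have hsub : {x : ℝ | 0 < x ∧ x ≤ T ∧ F t x = 0} ⊆ {x | x ∈ Icc (0 : ℝ) T ∧ G t x = 0} := by
    rintro x ⟨hx0, hxT, hFx⟩
    exact ⟨⟨hx0.le, hxT⟩, by simp [G, Φ, hFx]⟩
  refine (Set.encard_le_encard hsub).trans ?_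
  rw [← hfin.cast_ncard_eq, ← hreal_sum]
  exact_mod_cast hle

/-! Axiom census (expected `propext`, `Classical.choice`, `Quot.sound`). -/
#print axioms encard_realZeros_le_criticalZeroCount_of_nhds

end CountThin

end Summit.RiemannHypothesis.RiemannHypothesis.Theorems

end
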